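import Summits.QuantumFields.YangMills.Theorems.BalabanLadderIRTypLocalExcessMeas
import HarnessLib

/-!
# `Typ_lx^int`: the single-cell rarity BOOKKEEPING — atypicality is a finite union of per-ball excess events, so any
# per-ball bound that is uniform in the exterior sums to a single-cell any-exterior rarity bound (target (A′), part)

Support file for crux `IR` = stmt-QuantumFields-19354 (route-QuantumFields-BalabanLadder), registered line «af-pincer-Uc»
(`pub/ym-beyond/p2-g28-files/line-af-pincer-Uc.reg.lean` b6e69d9662b5b07a); lead prover of the line.  Count-neutral helper
(`--supports stmt-QuantumFields-19354`); it closes no stub.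

WHAT IS HERE (all proved; no `sorry`; axioms ⊆ {propext, Classical.choice, Quot.sound}).
* §1 Finiteness of the index set: an interior ball `(R, x)` of a cell of a mesh-`b` frame has its centre among the cell's
  sites and radius `R < b` (`mem_cellSites_of_isInteriorBall`, `lt_mesh_of_isInteriorBall`).
* §2 The per-ball BAD event `badBall ρ w R E c x = {U | ¬ LocalExcess ρ w R E c x U}` is open, hence measurable
  (`measurableSet_badBall`), and on an interior ball it lies inside the «Dirichlet excess ≥ E» event of the tree kernel's
  Hamiltonian `wilsonBoundaryAction ρ (ballLinks w c R x)` over the pinned class (`badBall_subset_excessEvent`) — the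
  shape in which per-ball kernel bounds are stated.
* §3 The decomposition `(TypLxInt ρ w Rs E c)ᶜ ⊆ ⋃_{x ∈ cellSites w c} ⋃_{R < b} badBall …` and the UNION BOUND for an
  arbitrary measure: per-ball bounds `μ (badBall R x) ≤ η R` (`η ≥ 0`, only interior balls with `R ∈ Rs` need a bound)
  give `μ (Typ_lx^int c)ᶜ ≤ (2b)⁴ · Σ_{R<b} η R` (`measure_compl_typLxInt_le`).
* §4 The kernel form: per-ball bounds UNIFORM IN THE EXTERIOR for the cell's own kernel
  `γ_{regionEdges w {c}}(ζ)` give single-cell any-exterior rarity of `Typ_lx^int` with budget `(2b)⁴ · Σ_{R<b} η R`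
  (`supCellRarity_typLxInt_of_ballBound`), and — budgets add over an intersection — of the WORKING CLASS
  `diluteTyp ∩ Typ_lx^int` with budget `δ_dil + (2b)⁴ · Σ_{R<b} η R` (`supCellRarity_workingClass_of_ballBound`), in the
  exact shape `∀ c ζ, γ_{regionEdges w {c}}(ζ) (Typ c)ᶜ ≤ ofReal δ` consumed by the tree upgrades
  `IRRarityUpgrade.supJointRarity_of_supCellRarity` / `torusJointRarity_of_supCellRarity`.
The per-ball bound itself (an energy–entropy estimate for the pinned Dirichlet problem, uniform in the exterior) is
the sequel of `…IRKernelLargeField` (seat ym-infvol-p3); this file is the consumer-side bookkeeping and assumes it as a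
hypothesis `hball`.

HONEST FRAMING: finite bookkeeping for ONE factor of ONE candidate class of ONE open stub (`stub_onsetUc`) of a CONDITIONAL
chain; clause (i) (mixing at a β-dependent mesh) untouched; not a gap, not Clay.
-/

set_option autoImplicit false

noncomputable section

open MeasureTheory Set
open scoped ENNReal
open Literature.MathematicalPhysics
open Literature.MathematicalPhysics.QuantumFieldTheory Literature.MathematicalPhysics.QuantumLattice
open Literature.Probability.LatticeModels (Site)
open Summit.QuantumFields.YangMills.Cruxes.IR.Tempered (cellEdges regionEdges)
open Summit.QuantumFields.YangMills.Theorems.OddTorusChessboard (cellSites mem_cellSites card_cellSites_le)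
open Summit.QuantumFields.YangMills.Theorems.IRKernelLargeField (diluteTyp)

namespace Summit.QuantumFields.YangMills.Theorems.IRTypLocalExcess

/-! ## §1 Interior balls: centre in the cell, radius below the mesh -/

section Index

variable {w : Fin 4 → ℤ → ℤ} {c : Fin 4 → ℤ} {R : ℕ} {x : Site 4}

/-- The centre of an interior ball is a site of the cell. -/
theorem mem_cellSites_of_isInteriorBall (h : IsInteriorBall w c R x) : x ∈ cellSites w c :=
  h x fun i => by rw [sub_self, abs_zero]; positivity

/-- On a frame whose cells have sides `≤ 2b`, an interior ball has radius `R < b` (the `(R+1)`-ball about the centre,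
`2R+3` sites across, fits in a side of length `≤ 2b`). -/
theorem lt_mesh_of_isInteriorBall {b : ℕ}
    (hw : ∀ i j, w i j + ((b : ℕ) : ℤ) ≤ w i (j + 1) ∧ w i (j + 1) ≤ w i j + 2 * ((b : ℕ) : ℤ))
    (h : IsInteriorBall w c R x) : R < b := by
  have hnear : ∀ (s : ℤ) (i : Fin 4), |s| ≤ (R : ℤ) + 1 →
      |(x + s • (Pi.single (0 : Fin 4) (1 : ℤ) : Site 4)) i - x i| ≤ (R : ℤ) + 1 := by
    intro s i hs
    rw [Pi.add_apply, add_sub_cancel_left, Pi.smul_apply, smul_eq_mul]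
    by_cases hi : i = 0
    · subst hi; rwa [Pi.single_eq_same, mul_one]
    · rw [Pi.single_eq_of_ne hi, mul_zero, abs_zero]; positivity
  have hup : (x + ((R : ℤ) + 1) • (Pi.single (0 : Fin 4) (1 : ℤ) : Site 4)) ∈ cellSites w c :=
    h _ fun i => hnear _ i (abs_le.2 ⟨by omega, le_rfl⟩)
  have hdn : (x + (-((R : ℤ) + 1)) • (Pi.single (0 : Fin 4) (1 : ℤ) : Site 4)) ∈ cellSites w c :=
    h _ fun i => hnear _ i (abs_le.2 ⟨by omega, by omega⟩)
  have h1 := (mem_cellSites.1 hup 0).2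
  have h2 := (mem_cellSites.1 hdn 0).1
  have h3 := (hw 0 (c 0)).2
  simp only [Pi.add_apply, Pi.smul_apply, Pi.single_eq_same, smul_eq_mul, mul_one] at h1 h2
  omega

end Index

/-! ## §2 The per-ball bad event -/

section Bad

variable {G : Type} [Group G] {N : ℕ} (ρ : G →* Matrix (Fin N) (Fin N) ℂ)

/-- **The bad event of the ball `(R, x)` of cell `c`**: local Dirichlet excess MORE than `E` (the complement of
`LocalExcess`). -/
def badBall (w : Fin 4 → ℤ → ℤ) (R : ℕ) (E : ℝ) (c : Fin 4 → ℤ) (x : Site 4) : Set (LGConfig 4 G) :=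
  {U | ¬ LocalExcess ρ w R E c x U}

/-- On an INTERIOR ball the bad event lies in the «Dirichlet excess at least `E`» event of the tree kernel's Hamiltonian
of the relaxable links over the pinned class (the shape of per-ball kernel bounds): some re-setting `V` of the relaxable
links, everything else pinned, has `S_{ballLinks}(V) + E ≤ S_{ballLinks}(U)`. -/
theorem badBall_subset_excessEvent {w : Fin 4 → ℤ → ℤ} {c : Fin 4 → ℤ} {R : ℕ} {x : Site 4}
    (hint : IsInteriorBall w c R x) (E : ℝ) :
    badBall ρ w R E c x ⊆ {U | ∃ V ∈ pinnedOff (ballLinks w c R x) U,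
      wilsonBoundaryAction ρ (ballLinks w c R x) V + E ≤ wilsonBoundaryAction ρ (ballLinks w c R x) U} := by
  intro U hU
  simp only [badBall, LocalExcess, mem_setOf_eq, not_forall, not_le, exists_prop] at hU
  obtain ⟨V, hV, hlt⟩ := hU
  refine ⟨V, hV, ?_⟩
  rw [← dirichletAction_eq_wilsonBoundaryAction ρ hint]
  exact hlt.le

variable [TopologicalSpace G] [IsTopologicalGroup G] [CompactSpace G] [MeasurableSpace G] [BorelSpace G]
  [SecondCountableTopology G]

/-- The bad event is measurable (it is open: the complement of the closed event `isClosed_localExcess`). -/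
theorem measurableSet_badBall (hρ : Continuous ρ) (w : Fin 4 → ℤ → ℤ) (R : ℕ) (E : ℝ) (c : Fin 4 → ℤ) (x : Site 4) :
    MeasurableSet (badBall ρ w R E c x) := by
  have h : badBall ρ w R E c x = {U | LocalExcess ρ w R E c x U}ᶜ := by ext U; rfl
  rw [h]
  exact (isClosed_localExcess ρ E (continuous_dirichletAction ρ hρ w R c x)).measurableSet.compl

end Bad

/-! ## §3 Atypicality is a finite union of bad events; the union bound for any measure -/

section Union

variable {G : Type} [Group G] {N : ℕ} (ρ : G →* Matrix (Fin N) (Fin N) ℂ)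

/-- **Decomposition.**  On a mesh-`b` frame, a configuration atypical for `Typ_lx^int` at cell `c` is bad on some
interior ball `(R, x)` with `x ∈ cellSites w c`, `R < b`, `R ∈ Rs`. -/
theorem compl_typLxInt_subset {b : ℕ} {w : Fin 4 → ℤ → ℤ}
    (hw : ∀ i j, w i j + ((b : ℕ) : ℤ) ≤ w i (j + 1) ∧ w i (j + 1) ≤ w i j + 2 * ((b : ℕ) : ℤ))
    (Rs : Set ℕ) (E : ℕ → ℝ) (c : Fin 4 → ℤ) :
    (TypLxInt (G := G) ρ w Rs E c)ᶜ ⊆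
      ⋃ x ∈ cellSites w c, ⋃ R ∈ Finset.range b,
        {U | R ∈ Rs ∧ IsInteriorBall w c R x ∧ U ∈ badBall ρ w R (E R) c x} := by
  intro U hU
  simp only [mem_compl_iff, TypLxInt, mem_setOf_eq, not_forall, exists_prop] at hU
  obtain ⟨R, x, hR, hint, hbad⟩ := hU
  simp only [mem_iUnion, mem_setOf_eq, exists_prop, Finset.mem_range]
  exact ⟨x, mem_cellSites_of_isInteriorBall hint, R, lt_mesh_of_isInteriorBall hw hint, hR, hint, hbad⟩

variable [MeasurableSpace G]

/-- **Union bound (any measure).**  Per-ball bounds `μ (badBall R x) ≤ η R` for the interior balls with `R ∈ Rs`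
(`η ≥ 0`) give `μ (Typ_lx^int c)ᶜ ≤ (2b)⁴ · Σ_{R<b} η R`. -/
theorem measure_compl_typLxInt_le (μ : Measure (LGConfig 4 G)) {b : ℕ} {w : Fin 4 → ℤ → ℤ}
    (hw : ∀ i j, w i j + ((b : ℕ) : ℤ) ≤ w i (j + 1) ∧ w i (j + 1) ≤ w i j + 2 * ((b : ℕ) : ℤ))
    {Rs : Set ℕ} {E : ℕ → ℝ} (c : Fin 4 → ℤ) {η : ℕ → ℝ} (hη : ∀ R, 0 ≤ η R)
    (hball : ∀ (R : ℕ) (x : Site 4), R ∈ Rs → IsInteriorBall w c R x →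
      μ (badBall ρ w R (E R) c x) ≤ ENNReal.ofReal (η R)) :
    μ (TypLxInt ρ w Rs E c)ᶜ ≤ ENNReal.ofReal ((2 * b : ℝ) ^ 4 * ∑ R ∈ Finset.range b, η R) := by
  classical
  have hsum : 0 ≤ ∑ R ∈ Finset.range b, η R := Finset.sum_nonneg fun R _ => hη R
  -- each summand of the decomposition is bounded by `η R`
  have hterm : ∀ (x : Site 4) (R : ℕ),
      μ {U | R ∈ Rs ∧ IsInteriorBall w c R x ∧ U ∈ badBall ρ w R (E R) c x} ≤ ENNReal.ofReal (η R) := by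
    intro x R
    by_cases hR : R ∈ Rs
    · by_cases hint : IsInteriorBall w c R x
      · have hset : {U | R ∈ Rs ∧ IsInteriorBall w c R x ∧ U ∈ badBall ρ w R (E R) c x} =
            badBall ρ w R (E R) c x := by
          ext U; simp [hR, hint]
        rw [hset]; exact hball R x hR hint
      · have hset : {U : LGConfig 4 G | R ∈ Rs ∧ IsInteriorBall w c R x ∧ U ∈ badBall ρ w R (E R) c x} = ∅ := by
          ext U; simp [hint]
        rw [hset, measure_empty]; exact bot_le
    · have hset : {U : LGConfig 4 G | R ∈ Rs ∧ IsInteriorBall w c R x ∧ U ∈ badBall ρ w R (E R) c x} = ∅ := by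
        ext U; simp [hR]
      rw [hset, measure_empty]; exact bot_le
  calc μ (TypLxInt ρ w Rs E c)ᶜ
      ≤ μ (⋃ x ∈ cellSites w c, ⋃ R ∈ Finset.range b,
          {U | R ∈ Rs ∧ IsInteriorBall w c R x ∧ U ∈ badBall ρ w R (E R) c x}) :=
        measure_mono (compl_typLxInt_subset ρ hw Rs E c)
    _ ≤ ∑ x ∈ cellSites w c, μ (⋃ R ∈ Finset.range b,
          {U | R ∈ Rs ∧ IsInteriorBall w c R x ∧ U ∈ badBall ρ w R (E R) c x}) :=
        measure_biUnion_finset_le _ _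
    _ ≤ ∑ x ∈ cellSites w c, ∑ R ∈ Finset.range b,
          μ {U | R ∈ Rs ∧ IsInteriorBall w c R x ∧ U ∈ badBall ρ w R (E R) c x} :=
        Finset.sum_le_sum fun x _ => measure_biUnion_finset_le _ _
    _ ≤ ∑ _x ∈ cellSites w c, ∑ R ∈ Finset.range b, ENNReal.ofReal (η R) :=
        Finset.sum_le_sum fun x _ => Finset.sum_le_sum fun R _ => hterm x R
    _ = ((cellSites w c).card : ℝ≥0∞) * ENNReal.ofReal (∑ R ∈ Finset.range b, η R) := by
        rw [Finset.sum_const, nsmul_eq_mul, ENNReal.ofReal_sum_of_nonneg fun R _ => hη R]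
    _ ≤ ENNReal.ofReal ((2 * b : ℝ) ^ 4) * ENNReal.ofReal (∑ R ∈ Finset.range b, η R) := by
        gcongr
        have h : ((cellSites w c).card : ℝ) ≤ (2 * b : ℝ) ^ 4 := by exact_mod_cast card_cellSites_le hw c
        rw [← ENNReal.ofReal_natCast]
        exact ENNReal.ofReal_le_ofReal h
    _ = ENNReal.ofReal ((2 * b : ℝ) ^ 4 * ∑ R ∈ Finset.range b, η R) := by
        rw [← ENNReal.ofReal_mul (by positivity)]

end Union

/-! ## §4 Kernel form: single-cell any-exterior rarity of `Typ_lx^int` and of the working class -/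

section Kernel

variable {G : Type} [Group G] [TopologicalSpace G] [IsTopologicalGroup G] [CompactSpace G]
  [MeasurableSpace G] [BorelSpace G] {N : ℕ} (ρ : G →* Matrix (Fin N) (Fin N) ℂ)

/-- **Single-cell any-exterior rarity of `Typ_lx^int` from per-ball bounds uniform in the exterior.**  On a
mesh-`b` frame, if for every cell `c`, every interior ball `(R, x)` with `R ∈ Rs` and EVERY exterior `ζ` the cell's
kernel gives the bad event probability `≤ η R` (`η ≥ 0`), then for every cell and every exterior
`γ_{regionEdges w {c}}(ζ) (Typ_lx^int c)ᶜ ≤ ofReal ((2b)⁴ · Σ_{R<b} η R)`. -/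
theorem supCellRarity_typLxInt_of_ballBound (β : ℝ) {b : ℕ} {w : Fin 4 → ℤ → ℤ}
    (hw : ∀ i j, w i j + ((b : ℕ) : ℤ) ≤ w i (j + 1) ∧ w i (j + 1) ≤ w i j + 2 * ((b : ℕ) : ℤ))
    {Rs : Set ℕ} {E : ℕ → ℝ} {η : ℕ → ℝ} (hη : ∀ R, 0 ≤ η R)
    (hball : ∀ (c : Fin 4 → ℤ) (R : ℕ) (x : Site 4), R ∈ Rs → IsInteriorBall w c R x → ∀ ζ : LGConfig 4 G,
      (ymSpecification ρ β (regionEdges w {c}) ζ) (badBall ρ w R (E R) c x) ≤ ENNReal.ofReal (η R)) :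
    ∀ (c : Fin 4 → ℤ) (ζ : LGConfig 4 G),
      (ymSpecification ρ β (regionEdges w {c}) ζ) (TypLxInt ρ w Rs E c)ᶜ ≤
        ENNReal.ofReal ((2 * b : ℝ) ^ 4 * ∑ R ∈ Finset.range b, η R) :=
  fun c ζ => measure_compl_typLxInt_le ρ _ hw c hη fun R x hR hint => hball c R x hR hint ζ

/-- **Single-cell any-exterior rarity of the WORKING CLASS `diluteTyp ∩ Typ_lx^int`** (budgets add): a dilute-tier
bound `δ_dil ≥ 0` uniform in the exterior and per-ball bounds `η ≥ 0` uniform in the exterior give, for every cell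
and every exterior, `γ_{regionEdges w {c}}(ζ) (WorkingClass … w c)ᶜ ≤ ofReal (δ_dil + (2b)⁴ · Σ_{R<b} η R)` — the
exact premiss `h1` of `IRRarityUpgrade.supJointRarity_of_supCellRarity` / `torusJointRarity_of_supCellRarity`. -/
theorem supCellRarity_workingClass_of_ballBound (β : ℝ) {b : ℕ} {w : Fin 4 → ℤ → ℤ}
    (hw : ∀ i j, w i j + ((b : ℕ) : ℤ) ≤ w i (j + 1) ∧ w i (j + 1) ≤ w i j + 2 * ((b : ℕ) : ℤ))
    {ℓ : ℕ} {T : ℝ} {Rs : Set ℕ} {E : ℕ → ℝ} {δdil : ℝ} (hδdil : 0 ≤ δdil) {η : ℕ → ℝ} (hη : ∀ R, 0 ≤ η R)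
    (hdil : ∀ (c : Fin 4 → ℤ) (ζ : LGConfig 4 G),
      (ymSpecification ρ β (regionEdges w {c}) ζ) (diluteTyp ρ w ℓ T c)ᶜ ≤ ENNReal.ofReal δdil)
    (hball : ∀ (c : Fin 4 → ℤ) (R : ℕ) (x : Site 4), R ∈ Rs → IsInteriorBall w c R x → ∀ ζ : LGConfig 4 G,
      (ymSpecification ρ β (regionEdges w {c}) ζ) (badBall ρ w R (E R) c x) ≤ ENNReal.ofReal (η R)) :
    ∀ (c : Fin 4 → ℤ) (ζ : LGConfig 4 G),
      (ymSpecification ρ β (regionEdges w {c}) ζ) (WorkingClass ρ ℓ T Rs E w c)ᶜ ≤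
        ENNReal.ofReal (δdil + (2 * b : ℝ) ^ 4 * ∑ R ∈ Finset.range b, η R) := by
  intro c ζ
  have hsum : 0 ≤ (2 * b : ℝ) ^ 4 * ∑ R ∈ Finset.range b, η R :=
    mul_nonneg (by positivity) (Finset.sum_nonneg fun R _ => hη R)
  rw [WorkingClass, Set.compl_inter, ENNReal.ofReal_add hδdil hsum]
  exact (measure_union_le _ _).trans
    (add_le_add (hdil c ζ) (supCellRarity_typLxInt_of_ballBound ρ β hw hη hball c ζ))

end Kernel

end Summit.QuantumFields.YangMills.Theorems.IRTypLocalExcess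

end
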